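import Literature.NumberTheory.Automorphic.UnitaryGroupLocalCenterScalar
import Literature.NumberTheory.Automorphic.UnitaryGroupPlaceInclusion
import Literature.NumberTheory.Automorphic.UnitaryGroupAdelicOneTorusDictionary
import Literature.NumberTheory.Automorphic.TorusCharacterLocalComponents
import Literature.NumberTheory.Automorphic.UnitaryGroupSplitPlace
import HarnessLib

/-!
# The local central scalar `t · 1_N ∈ U(J)(F_v)` IS the adelic centre of the local torus element `(…, 1, t, 1, …) ∈ U(1)(𝔸_F)`

Topic `NumberTheory/Automorphic`; namespace `Literature.NumberTheory.Automorphic.UnitaryGroup`.  PROOF FILE (theorems only; no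
definition, no named fact, no instance, no notation, no `sorry`).  Setting: a quadratic extension of number fields `E/F` with
non-trivial automorphism `c`, a hermitian form `J` of rank `N`, a hermitian LINE `J₁ = (j)`, `j ≠ 0` (so `U(J₁) = U(1)`), a finite
place `v` of `F`, and a norm-one semi-local unit `t ∈ T(F_v) = U(1)(F_v) = {x ∈ (E ⊗_F F_v)ˣ : (c ⊗ 1)(x) · x = 1}`
(★ `normOneUnits (conjLocal E c v)`).  Two central elements of `U(J)(𝔸_F)` are attached to `t`:

* the LOCAL road: `t` as the `1 × 1` unitary matrix `localUnitScalar t ∈ U(J₁)(F_v)` (★ `UnitaryGroupLocalCenterScalar`), pushed by the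
  local centre `localCenter : U(J₁)(F_v) → U(J)(F_v)` (`(g_w)_w ↦ ((g_w)₀₀ · 1_N)_w`, ★ `UnitaryGroupFinAdelicCenterLocal`) and then
  by the place inclusion `inclPlaceAdelic v : U(J)(F_v) → U(J)(𝔸_F)` (★ `UnitaryGroupPlaceInclusion`);
* the ADELIC road: `t` as the torus idèle `locTorusIncl v t ∈ T(𝔸_F)` (component `t_w` at `w ∣ v`, `1` elsewhere, ★
  `TorusCharacterLocalComponents`), read in `U(1)(𝔸_F) = adelicOne` (★ `adelicOneEquivTorus`) and pushed by the adelic centre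
  `adelicCenter : U(1)(𝔸_F) → U(J)(𝔸_F)`, `u ↦ u · 1_N` (★ `UnitaryGroupAdelicCenter`).

THE THEOREM (`inclPlaceAdelic_localCenter_localUnitScalar`): **the two coincide** —
`inclPlaceAdelic v (localCenter (localUnitScalar t)) = adelicCenter (adelicOneEquivTorus⁻¹ (locTorusIncl v t))`.
Proof: both underlying matrices in `M_N(𝔸_E)`, `𝔸_E = E_∞ × 𝔸_E^∞`, have archimedean part `1_N` (★ `map_fst_ofFinite`, ★
`semilocalUnits_fst`) and finite part the scalar matrix whose `w`-component is `t_w · 1_N` for `w ∣ v` (★ `evalAt_inclPlace_of_over`, ★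
`coe_localScalarGL_apply`, ★ `coe_localUnitScalar_apply` ∕ ★ `semilocalUnits_snd_apply_of_over`) and `1_N` for `w ∤ v` (★
`evalAt_inclPlace_of_not_over` ∕ ★ `semilocalUnits_snd_apply_of_not_over`).  §2 adds the SPLIT-PLACE reading: under the projection
`U(J)(F_v) ≃ GL_N(E_w)` at a place `w ∣ v` moved by `c` (★ `localPiSplitEquiv` ∕ ★ `localSplitEquiv`) the central element is the scalar
matrix `t_w · 1_N`.

USE (Hodge-CM programme, crux H413, LH1 «ZENTRUM» sub-leaf, organ O-SPLIT): a discrete automorphic `P` on which the adelic centre acts by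
`ψ_P` (★ `exists_centralCharacter_adelicCenter`) has, at a split `v`, local constituents on which `t · 1_N` acts by `ψ_P(locTorusIncl v t)` —
this identity is the bridge between the two currencies (sub-brick SB3 of the (B4) cut).

## References
* C. P. Mok, *Endoscopic classification of representations of quasi-split unitary groups*, Mem. AMS 235 (2015), §1 Notation p. 5 (the
  centre of `U_{E/F}(N)` is `U_{E/F}(1) = E¹`) [Mok2014].
* V. Platonov, A. Rapinchuk, *Algebraic Groups and Number Theory* (1994), §5.1 (adelic points and place inclusions), §6.2 (the norm-one
  torus) [PlatonovRapinchuk1994].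
* A. Borel, H. Jacquet, *Automorphic forms and automorphic representations*, Proc. Symp. Pure Math. 33.1 (1979), §4.1 [BorelJacquet1979].
-/

set_option autoImplicit false

noncomputable section

open scoped Matrix
open NumberField IsDedekindDomain
open Literature.NumberTheory.GaloisRepresentations
open Literature.NumberTheory.Automorphic.Arthur2013.Leaves.TECR

namespace Literature.NumberTheory.Automorphic

namespace UnitaryGroup

variable (F E : Type) [Field F] [NumberField F] [Field E] [NumberField E] [Algebra F E]
  (c : E ≃ₐ[F] E) (N : ℕ) (J : Matrix (Fin N) (Fin N) E) (J₁ : Matrix (Fin 1) (Fin 1) E) (hJ₁ : J₁ 0 0 ≠ 0)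
  (v : HeightOneSpectrum (𝓞 F))

/-! ## §1 Norm-one semi-local units as central elements: the local and the adelic road agree -/

/-- The norm-one relation of `t ∈ T(F_v)` in the order `t · (c ⊗ 1)(t) = 1` consumed by ★ `localUnitScalar`.
[cite: Mok2014, §1 Notation p. 5] -/
theorem coe_mul_conjLocal_eq_one_of_mem_normOneUnits (t : ↥(normOneUnits (conjLocal E c v))) :
    ((t : (LocalRing E v)ˣ) : LocalRing E v) * conjLocal E c v ((t : (LocalRing E v)ˣ) : LocalRing E v) = 1 := by
  rw [mul_comm]
  exact (mem_normOneUnits_iff (t : (LocalRing E v)ˣ)).1 t.2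

/-- The underlying idèle of the adelic-road element: `adelicOneEquivTorus⁻¹ (locTorusIncl v t)` IS the semi-local unit idèle
`semilocalUnits v t` (component `t_w` at `w ∣ v`, `1` elsewhere). [cite: PlatonovRapinchuk1994, §6.2] -/
theorem coe_adelicOneEquivTorus_symm_locTorusIncl (t : ↥(normOneUnits (conjLocal E c v))) :
    (((adelicOneEquivTorus F E c).symm (locTorusIncl E c v t) : adelicOne F E c) : (AdeleRing (𝓞 E) E)ˣ) =
      semilocalUnits E v (t : (LocalRing E v)ˣ) := rfl

/-- The matrix of the local-road element: the underlying adelic matrix of `inclPlaceAdelic v (localCenter (localUnitScalar t))` is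
`GLn.ofFinite` of the finite-adelic matrix of `inclPlace v (localCenter (localUnitScalar t))`. [cite: BorelJacquet1979, §4.1] -/
theorem coe_inclPlaceAdelic_localCenter_localUnitScalar (t : ↥(normOneUnits (conjLocal E c v))) :
    adelicVal F E c N J (inclPlaceAdelic F E c N J v (localCenter E c N J J₁ hJ₁ v
        (localUnitScalar E c J₁ v (t : (LocalRing E v)ˣ) (coe_mul_conjLocal_eq_one_of_mem_normOneUnits F E c v t)))) =
      GLn.ofFinite N E ((inclPlace F E c N J v (localCenter E c N J J₁ hJ₁ v
        (localUnitScalar E c J₁ v (t : (LocalRing E v)ˣ) (coe_mul_conjLocal_eq_one_of_mem_normOneUnits F E c v t))) :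
          finAdelic F E c N J) : GL (Fin N) (FiniteAdeleRing (𝓞 E) E)) := rfl

/-- The `w`-component, `w ∣ v`, of the finite-adelic matrix of `inclPlace v (localCenter (localUnitScalar t))` is the scalar matrix
`t_w · 1_N`. [cite: Mok2014, §1 Notation p. 5] -/
theorem evalAt_inclPlace_localCenter_localUnitScalar_of_over (t : ↥(normOneUnits (conjLocal E c v))) (w : PlacesOver E v) :
    ((GLn.evalAt N E w.1 ((inclPlace F E c N J v (localCenter E c N J J₁ hJ₁ v
        (localUnitScalar E c J₁ v (t : (LocalRing E v)ˣ) (coe_mul_conjLocal_eq_one_of_mem_normOneUnits F E c v t))) :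
          finAdelic F E c N J) : GL (Fin N) (FiniteAdeleRing (𝓞 E) E)) : GL (Fin N) (w.1.adicCompletion E)) :
        Matrix (Fin N) (Fin N) (w.1.adicCompletion E)) =
      ((t : (LocalRing E v)ˣ) : LocalRing E v) w • (1 : Matrix (Fin N) (Fin N) (w.1.adicCompletion E)) := by
  rw [evalAt_inclPlace_of_over, coe_localCenter, coe_localScalarGL_apply, coe_localUnitScalar_apply]

/-- The `w`-component, `w ∤ v`, of the finite-adelic matrix of `inclPlace v (localCenter (localUnitScalar t))` is `1_N`.
[cite: Mok2014, §1 Notation p. 5] -/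
theorem evalAt_inclPlace_localCenter_localUnitScalar_of_not_over (t : ↥(normOneUnits (conjLocal E c v)))
    {q : HeightOneSpectrum (𝓞 E)} (hq : q.under (𝓞 F) ≠ v) :
    ((GLn.evalAt N E q ((inclPlace F E c N J v (localCenter E c N J J₁ hJ₁ v
        (localUnitScalar E c J₁ v (t : (LocalRing E v)ˣ) (coe_mul_conjLocal_eq_one_of_mem_normOneUnits F E c v t))) :
          finAdelic F E c N J) : GL (Fin N) (FiniteAdeleRing (𝓞 E) E)) : GL (Fin N) (q.adicCompletion E)) :
        Matrix (Fin N) (Fin N) (q.adicCompletion E)) = 1 := by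
  rw [evalAt_inclPlace_of_not_over F E c N J hq _ ⟨q, rfl⟩]
  rfl

/-- **THE LOCAL CENTRAL SCALAR IS THE ADELIC CENTRE OF THE LOCAL TORUS ELEMENT.**  For a norm-one semi-local unit `t ∈ T(F_v)`:
`inclPlaceAdelic v (localCenter (localUnitScalar t)) = adelicCenter (adelicOneEquivTorus⁻¹ (locTorusIncl v t))` in `U(J)(𝔸_F)` — the scalar
`t · 1_N` placed at `v` equals the scalar matrix of the idèle `(…, 1, t, 1, …)`.  (Matrix extensionality over `𝔸_E = E_∞ × 𝔸_E^∞`, then place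
by place in `𝔸_E^∞`.) [cite: Mok2014, §1 Notation p. 5] [cite: PlatonovRapinchuk1994, §5.1, §6.2] -/
theorem inclPlaceAdelic_localCenter_localUnitScalar (t : ↥(normOneUnits (conjLocal E c v))) :
    inclPlaceAdelic F E c N J v (localCenter E c N J J₁ hJ₁ v
        (localUnitScalar E c J₁ v (t : (LocalRing E v)ˣ) (coe_mul_conjLocal_eq_one_of_mem_normOneUnits F E c v t))) =
      adelicCenter F E c N J ((adelicOneEquivTorus F E c).symm (locTorusIncl E c v t)) := by
  apply Subtype.ext
  apply Units.ext
  change ((GLn.ofFinite N E ((inclPlace F E c N J v (localCenter E c N J J₁ hJ₁ v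
      (localUnitScalar E c J₁ v (t : (LocalRing E v)ˣ) (coe_mul_conjLocal_eq_one_of_mem_normOneUnits F E c v t))) :
        finAdelic F E c N J) : GL (Fin N) (FiniteAdeleRing (𝓞 E) E)) : GL (Fin N) (AdeleRing (𝓞 E) E)) :
      Matrix (Fin N) (Fin N) (AdeleRing (𝓞 E) E)) =
    (((adelicCenter F E c N J ((adelicOneEquivTorus F E c).symm (locTorusIncl E c v t)) : adelic F E c N J) :
        GL (Fin N) (AdeleRing (𝓞 E) E)) : Matrix (Fin N) (Fin N) (AdeleRing (𝓞 E) E))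
  rw [coe_adelicCenter, coe_adelicOneEquivTorus_symm_locTorusIncl]
  refine matrix_adele_ext E N ?_ ?_
  · -- archimedean parts: `1_N` on both sides
    rw [map_fst_ofFinite, map_smul_one N (adeleFst E)]
    change _ = ((semilocalUnits E v (t : (LocalRing E v)ˣ) : ideleGroup E) : AdeleRing (𝓞 E) E).1 • _
    rw [semilocalUnits_fst, one_smul]
  · -- finite parts: place by place
    rw [map_snd_ofFinite, map_smul_one N (adeleSnd E)]
    change _ = ((semilocalUnits E v (t : (LocalRing E v)ˣ) : ideleGroup E) : AdeleRing (𝓞 E) E).2 • _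
    rw [Matrix.finiteAdele_eq_iff_forall]
    intro q
    rw [map_eval_eq_evalAt, map_smul_one N (AdelicGroupData.finiteAdeleEval E q), AdelicGroupData.finiteAdeleEval_apply]
    by_cases hq : q.under (𝓞 F) = v
    · rw [evalAt_inclPlace_localCenter_localUnitScalar_of_over F E c N J J₁ hJ₁ v t ⟨q, hq⟩,
        semilocalUnits_snd_apply_of_over E (t : (LocalRing E v)ˣ) ⟨q, hq⟩]
    · rw [evalAt_inclPlace_localCenter_localUnitScalar_of_not_over F E c N J J₁ hJ₁ v t hq,
        semilocalUnits_snd_apply_of_not_over E (t : (LocalRing E v)ˣ) hq, one_smul]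

/-- The same identity read on the torus side: with `u := adelicOneEquivTorus⁻¹ (locTorusIncl v t)`, `adelicCenter u` is the
local central scalar at `v`. [cite: Mok2014, §1 Notation p. 5] -/
theorem adelicCenter_adelicOneEquivTorus_symm_locTorusIncl (t : ↥(normOneUnits (conjLocal E c v))) :
    adelicCenter F E c N J ((adelicOneEquivTorus F E c).symm (locTorusIncl E c v t)) =
      inclPlaceAdelic F E c N J v (localCenter E c N J J₁ hJ₁ v
        (localUnitScalar E c J₁ v (t : (LocalRing E v)ˣ) (coe_mul_conjLocal_eq_one_of_mem_normOneUnits F E c v t))) :=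
  (inclPlaceAdelic_localCenter_localUnitScalar F E c N J J₁ hJ₁ v t).symm

/-! ## §2 The split-place reading: under `U(J)(F_v) ≃ GL_N(E_w)` the central element is the scalar matrix `t_w · 1_N` -/

variable {F N v} [Algebra.IsQuadraticExtension F E]

/-- At a place `w ∣ v` moved by `c` (a split `v`), the projection `U(J)(F_v) ≃ GL_N(E_w)` (★ `localPiSplitEquiv`) sends the local central
scalar `localCenter (localUnitScalar t)` to the scalar matrix `t_w · 1_N`. [cite: Mok2014, §1 Notation p. 5] -/
theorem coe_localPiSplitEquiv_localCenter_localUnitScalar (hc : c ≠ 1) (hJ : (J.map c)ᵀ = J) (w : PlacesOver E v)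
    (hw : c • w.1 ≠ w.1) (hJw : IsUnit (placeForm J w.1)) (z : (LocalRing E v)ˣ)
    (hz : (z : LocalRing E v) * conjLocal E c v z = 1) :
    ((localPiSplitEquiv c J hc hJ w hw hJw (localCenter E c N J J₁ hJ₁ v (localUnitScalar E c J₁ v z hz)) :
        GL (Fin N) (w.1.adicCompletion E)) : Matrix (Fin N) (Fin N) (w.1.adicCompletion E)) =
      (z : LocalRing E v) w • (1 : Matrix (Fin N) (Fin N) (w.1.adicCompletion E)) := by
  rw [localPiSplitEquiv_apply, coe_localCenter, coe_localScalarGL_apply, coe_localUnitScalar_apply]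

/-- The same as an identity of invertible matrices: the image is `Matrix.scalar N (t_w)` lifted to `GL_N(E_w)` by `Units.map`.
[cite: Mok2014, §1 Notation p. 5] -/
theorem localPiSplitEquiv_localCenter_localUnitScalar (hc : c ≠ 1) (hJ : (J.map c)ᵀ = J) (w : PlacesOver E v)
    (hw : c • w.1 ≠ w.1) (hJw : IsUnit (placeForm J w.1)) (z : (LocalRing E v)ˣ)
    (hz : (z : LocalRing E v) * conjLocal E c v z = 1) :
    localPiSplitEquiv c J hc hJ w hw hJw (localCenter E c N J J₁ hJ₁ v (localUnitScalar E c J₁ v z hz)) =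
      Units.map (Matrix.scalar (Fin N) : w.1.adicCompletion E →+* Matrix (Fin N) (Fin N) (w.1.adicCompletion E)).toMonoidHom
        (MulEquiv.piUnits z w) := by
  refine Units.ext ?_
  rw [coe_localPiSplitEquiv_localCenter_localUnitScalar, Units.coe_map, RingHom.toMonoidHom_eq_coe, MonoidHom.coe_coe,
    Matrix.scalar_apply, Matrix.smul_one_eq_diagonal]
  rfl

/-- The matrix-model form: `localSplitEquiv = localPiEquiv⁻¹ ≫ localPiSplitEquiv` (★ `localSplitEquiv`) sends `localPiEquiv` of the local central
scalar to `t_w · 1_N`. [cite: Mok2014, §1 Notation p. 5] -/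
theorem coe_localSplitEquiv_localPiEquiv_localCenter_localUnitScalar (hc : c ≠ 1) (hJ : (J.map c)ᵀ = J) (w : PlacesOver E v)
    (hw : c • w.1 ≠ w.1) (hJw : IsUnit (placeForm J w.1)) (z : (LocalRing E v)ˣ)
    (hz : (z : LocalRing E v) * conjLocal E c v z = 1) :
    ((localSplitEquiv c J hc hJ w hw hJw (localPiEquiv E c N J v (localCenter E c N J J₁ hJ₁ v (localUnitScalar E c J₁ v z hz))) :
        GL (Fin N) (w.1.adicCompletion E)) : Matrix (Fin N) (Fin N) (w.1.adicCompletion E)) =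
      (z : LocalRing E v) w • (1 : Matrix (Fin N) (Fin N) (w.1.adicCompletion E)) := by
  rw [localSplitEquiv, ContinuousMulEquiv.trans_apply, ContinuousMulEquiv.symm_apply_apply,
    coe_localPiSplitEquiv_localCenter_localUnitScalar]

/-! ## §3 The matrix-model currency: the central scalar BY HYPOTHESIS `(z : M_N(E ⊗_F F_v)) = t · 1_N` (no line `J₁` needed)

The hypothesis is spelled `(z : GL (Fin N) (LocalRing E v)).val = t • 1` (`Units.val`, definitionally the coercion to matrices; the
`((· : GL _ (LocalRing E v)) : Matrix _ _ (LocalRing E v))` double ascription does not elaborate over the product ring in this import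
cone). -/

omit [Algebra.IsQuadraticExtension F E] in
/-- **Non-vacuity**: the scalar matrix `t · 1_N` IS an element of `U(J)(F_v) ≤ GL_N(E ⊗_F F_v)` (matrix model ★ `«local»`) for every
norm-one semi-local unit `t` (★ `scalar_mem_unitaryGroupOfForm`). [cite: Mok2014, §1 Notation p. 5] -/
theorem exists_local_coe_eq_smul_one (t : ↥(normOneUnits (conjLocal E c v))) :
    ∃ z : ↥(«local» E c N J v),
      (z : GL (Fin N) (LocalRing E v)).val =
        ((t : (LocalRing E v)ˣ) : LocalRing E v) • (1 : Matrix (Fin N) (Fin N) (LocalRing E v)) := by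
  refine ⟨⟨Units.map (Matrix.scalar (Fin N) : LocalRing E v →+* Matrix (Fin N) (Fin N) (LocalRing E v)).toMonoidHom
      (t : (LocalRing E v)ˣ), scalar_mem_unitaryGroupOfForm (conjLocal E c v) _ _ ((mem_normOneUnits_iff _).1 t.2)⟩, ?_⟩
  change (Units.map (Matrix.scalar (Fin N) : LocalRing E v →+* Matrix (Fin N) (Fin N) (LocalRing E v)).toMonoidHom
      (t : (LocalRing E v)ˣ)).val = _
  rw [Units.coe_map, RingHom.toMonoidHom_eq_coe, MonoidHom.coe_coe, Matrix.scalar_apply, Matrix.smul_one_eq_diagonal]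

omit [Algebra.IsQuadraticExtension F E] in
/-- The `w`-component (`w ∣ v`) of the regrouped tuple `localPiEquiv⁻¹ z ∈ Π_{w ∣ v} GL_N(E_w)` of a matrix-model element `z` with
`(z : M_N) = t · 1_N` is the scalar matrix `t_w · 1_N`. [cite: Mok2014, §1 Notation p. 5] -/
theorem coe_localPiEquiv_symm_apply_of_coe_eq_smul_one (t : ↥(normOneUnits (conjLocal E c v))) (z : ↥(«local» E c N J v))
    (hz : (z : GL (Fin N) (LocalRing E v)).val =
      ((t : (LocalRing E v)ˣ) : LocalRing E v) • (1 : Matrix (Fin N) (Fin N) (LocalRing E v))) (w : PlacesOver E v) :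
    (((((localPiEquiv E c N J v).symm z : localPi E c N J v) : LocalGLPi E N v) w : GL (Fin N) (w.1.adicCompletion E)) :
        Matrix (Fin N) (Fin N) (w.1.adicCompletion E)) =
      ((t : (LocalRing E v)ˣ) : LocalRing E v) w • (1 : Matrix (Fin N) (Fin N) (w.1.adicCompletion E)) := by
  rw [coe_localPiEquiv_symm_apply, GLn.coe_piEquiv_apply, hz,
    map_smul_one N (Pi.evalRingHom (fun w : PlacesOver E v => w.1.adicCompletion E) w)]
  rfl

omit [Algebra.IsQuadraticExtension F E] in
/-- **THE (Z2b) IDENTITY IN THE MATRIX-MODEL CURRENCY**: for `z ∈ U(J)(F_v)` (matrix model) with `(z : M_N) = t · 1_N`,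
`inclPlaceAdelic v (localPiEquiv⁻¹ z) = adelicCenter (adelicOneEquivTorus⁻¹ (locTorusIncl v t))` — the shape consumed by the O-SPLIT assembly
(`LocalConstituentsIn` reads the local representation through `localPiEquiv`). [cite: Mok2014, §1 Notation p. 5] [cite: PlatonovRapinchuk1994, §5.1, §6.2] -/
theorem inclPlaceAdelic_localPiEquiv_symm_of_coe_eq_smul_one (t : ↥(normOneUnits (conjLocal E c v)))
    (z : ↥(«local» E c N J v))
    (hz : (z : GL (Fin N) (LocalRing E v)).val =
      ((t : (LocalRing E v)ˣ) : LocalRing E v) • (1 : Matrix (Fin N) (Fin N) (LocalRing E v))) :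
    inclPlaceAdelic F E c N J v ((localPiEquiv E c N J v).symm z) =
      adelicCenter F E c N J ((adelicOneEquivTorus F E c).symm (locTorusIncl E c v t)) := by
  apply Subtype.ext
  apply Units.ext
  change ((GLn.ofFinite N E ((inclPlace F E c N J v ((localPiEquiv E c N J v).symm z) : finAdelic F E c N J) :
      GL (Fin N) (FiniteAdeleRing (𝓞 E) E)) : GL (Fin N) (AdeleRing (𝓞 E) E)) : Matrix (Fin N) (Fin N) (AdeleRing (𝓞 E) E)) =
    (((adelicCenter F E c N J ((adelicOneEquivTorus F E c).symm (locTorusIncl E c v t)) : adelic F E c N J) :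
        GL (Fin N) (AdeleRing (𝓞 E) E)) : Matrix (Fin N) (Fin N) (AdeleRing (𝓞 E) E))
  rw [coe_adelicCenter, coe_adelicOneEquivTorus_symm_locTorusIncl]
  refine matrix_adele_ext E N ?_ ?_
  · rw [map_fst_ofFinite, map_smul_one N (adeleFst E)]
    change _ = ((semilocalUnits E v (t : (LocalRing E v)ˣ) : ideleGroup E) : AdeleRing (𝓞 E) E).1 • _
    rw [semilocalUnits_fst, one_smul]
  · rw [map_snd_ofFinite, map_smul_one N (adeleSnd E)]
    change _ = ((semilocalUnits E v (t : (LocalRing E v)ˣ) : ideleGroup E) : AdeleRing (𝓞 E) E).2 • _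
    rw [Matrix.finiteAdele_eq_iff_forall]
    intro q
    rw [map_eval_eq_evalAt, map_smul_one N (AdelicGroupData.finiteAdeleEval E q), AdelicGroupData.finiteAdeleEval_apply]
    by_cases hq : q.under (𝓞 F) = v
    · rw [evalAt_inclPlace_of_over F E c N J v _ ⟨q, hq⟩, coe_localPiEquiv_symm_apply_of_coe_eq_smul_one E c J t z hz ⟨q, hq⟩,
        semilocalUnits_snd_apply_of_over E (t : (LocalRing E v)ˣ) ⟨q, hq⟩]
    · rw [evalAt_inclPlace_of_not_over F E c N J hq _ ⟨q, rfl⟩, semilocalUnits_snd_apply_of_not_over E (t : (LocalRing E v)ˣ) hq,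
        one_smul]
      rfl

/-- **The split-place reading in the matrix-model currency**: at a place `w ∣ v` moved by `c`, `localSplitEquiv` (★; = the CM packet files'
`cmSplitEquiv` by `rfl`) sends a matrix-model element `z` with `(z : M_N) = t · 1_N` to the scalar matrix `t_w · 1_N ∈ GL_N(E_w)` — the
`(· : Matrix) = u • 1` shape consumed by ★ `splitMemberGL_apply_of_coe_eq_smul_one`. [cite: Mok2014, §1 Notation p. 5] -/
theorem coe_localSplitEquiv_of_coe_eq_smul_one (hc : c ≠ 1) (hJ : (J.map c)ᵀ = J) (w : PlacesOver E v) (hw : c • w.1 ≠ w.1)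
    (hJw : IsUnit (placeForm J w.1)) (t : ↥(normOneUnits (conjLocal E c v))) (z : ↥(«local» E c N J v))
    (hz : (z : GL (Fin N) (LocalRing E v)).val =
      ((t : (LocalRing E v)ˣ) : LocalRing E v) • (1 : Matrix (Fin N) (Fin N) (LocalRing E v))) :
    ((localSplitEquiv c J hc hJ w hw hJw z : GL (Fin N) (w.1.adicCompletion E)) : Matrix (Fin N) (Fin N) (w.1.adicCompletion E)) =
      ((MulEquiv.piUnits (t : (LocalRing E v)ˣ) w : (w.1.adicCompletion E)ˣ) : w.1.adicCompletion E) •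
        (1 : Matrix (Fin N) (Fin N) (w.1.adicCompletion E)) := by
  rw [localSplitEquiv, ContinuousMulEquiv.trans_apply, localPiSplitEquiv_apply,
    coe_localPiEquiv_symm_apply_of_coe_eq_smul_one E c J t z hz w]
  rfl

end UnitaryGroup

end Literature.NumberTheory.Automorphic

end
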